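import Mathlib
import Summits.ValiantsHypothesis.ValiantsHypothesis.Theorems.BarrierLeverPartitionMinorsHitByVPHiddenStatesCoStarLowerCells

/-!
# Route BarrierLever — item `PartitionMinorsHitByVP` (stmt-ValiantsHypothesis-19717), line `hidden-states`:
# THE CO-STAR RECURSION, part 3b — `SatFour` (saturated dimension 4 is never stuck) and the lower node cell `r = 2^h − 5` for EVERY `h ≥ 4`

Helper file (`--supports stmt-ValiantsHypothesis-19717`; cell valiant-natproofs, rung V4, 𝒟-side door (c), registered line
`Cruxes/PartitionMinorsHitByVP/Lines/hidden_states.lean` v7; prover seat val-np-p6 gen 11). Definition-free; closes NO item.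

* `satFour` — an up-closed family `𝒜` of FIVE subsets of a 4-element block `Y` has a coordinate avoided by EXACTLY one member. (If some member `D`
  has `|D| ≤ 2`, its up-closure `[D, Y]` already has `2^{|Y ∖ D|} ≤ 5` members, so `|Y ∖ D| = 2`, `𝒜 = [D, Y] ⊔ {E}` and any `d ∈ D ∖ E` is avoided by
  `E` alone; otherwise every member other than `Y` is a facet `Y ∖ x`, avoided by itself alone.) This discharges the hypothesis of the `c = 4` branch of
  the recursion theorem `SymbJoin.coStar_subcube_symGood` (part 2/3): the saturated co-star `T_{4,4} = B₂([4])` node always admits the facet stack (R2′).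
* `coStarLower_exists_table_le_four` — THE LOWER CO-STAR THEOREM up to co-size 5, unconditionally: for every `h` and `c ≤ 4` the co-star `T_{h,c}`
  serves every injective LOWER row family of size `2^h − (c+1)`.
* **`universalJoinWideLower_top_five`**, `universalJoinWideLower_top_le_five` — the body of `LowerNode.Stmt.universalJoinWideLower` (p599518) at
  `r = 2^h − 5` for EVERY `h ≥ 4`, and uniformly at the top five sizes of every `h ≥ 4` (one piece, `K = h`).

By the block reduction (memo val-np-p6 g10 §10) co-size 5 for all `h` is equivalent to the 13 saturated instances of dimension 4; here they are
settled structurally (every one is facet-peelable), not by certificate. The first co-size needing a genuine certificate is 6 (dimension-5 saturated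
up-sets such as `{123,23,13,12,3,1} ⊕ {4,5}` admit no facet stack). WHAT THIS IS NOT: no stub of the line is closed; nothing on crux 14610 or VP ≠ VNP.
-/

set_option linter.dupNamespace false

namespace Summit.ValiantsHypothesis.ValiantsHypothesis.Theorems.BarrierLever.HiddenStates

open Finset Matrix MvPolynomial

noncomputable section

namespace CoStar

variable {n : ℕ}

/-! ## 1. Saturated dimension 4 is never stuck -/

/-- **`SatFour`.** An up-closed family of `5` subsets of a `4`-element block has a coordinate avoided by exactly one member. -/
theorem satFour (Y : Finset (Fin n)) (𝒜 : Finset (Finset (Fin n))) (hY : Y.card = 4) (h𝒜Y : ∀ A ∈ 𝒜, A ⊆ Y)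
    (hup : ∀ A ∈ 𝒜, ∀ A', A ⊆ A' → A' ⊆ Y → A' ∈ 𝒜) (hcard : 𝒜.card = 5) :
    ∃ x ∈ Y, (𝒜.filter fun A => x ∉ A).card = 1 := by
  classical
  by_cases hdeep : ∃ D ∈ 𝒜, D.card ≤ 2
  · /- a deep member `D`: its up-closure is an interval of `2^{|Y ∖ D|}` members -/
    obtain ⟨D, hD, hDc⟩ := hdeep
    have hDY : D ⊆ Y := h𝒜Y D hD
    set I : Finset (Finset (Fin n)) := (Y \ D).powerset.image fun S => D ∪ S with hI
    have hIcard : I.card = 2 ^ (Y \ D).card := by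
      rw [hI, Finset.card_image_of_injOn, Finset.card_powerset]
      intro S hS S' hS' hSS
      simp only [Finset.coe_powerset, Set.mem_preimage, Set.mem_powerset_iff, Finset.coe_subset] at hS hS'
      simp only at hSS
      have h1 : (D ∪ S) \ D = S := Finset.union_sdiff_cancel_left (Finset.disjoint_of_subset_right hS Finset.disjoint_sdiff)
      have h2 : (D ∪ S') \ D = S' := Finset.union_sdiff_cancel_left (Finset.disjoint_of_subset_right hS' Finset.disjoint_sdiff)
      rw [← h1, ← h2, hSS]
    have hIsub : I ⊆ 𝒜 := by
      intro A hA
      obtain ⟨S, hS, rfl⟩ := Finset.mem_image.mp hA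
      rw [Finset.mem_powerset] at hS
      exact hup D hD _ Finset.subset_union_left (Finset.union_subset hDY (hS.trans Finset.sdiff_subset))
    have hmemI : ∀ A, A ∈ I ↔ D ⊆ A ∧ A ⊆ Y := by
      intro A
      rw [hI, Finset.mem_image]
      constructor
      · rintro ⟨S, hS, rfl⟩
        rw [Finset.mem_powerset] at hS
        exact ⟨Finset.subset_union_left, Finset.union_subset hDY (hS.trans Finset.sdiff_subset)⟩
      · rintro ⟨hDA, hAY⟩
        refine ⟨A \ D, Finset.mem_powerset.mpr (Finset.sdiff_subset_sdiff hAY subset_rfl), Finset.union_sdiff_of_subset hDA⟩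
    -- counting: `2^{|Y ∖ D|} ≤ 5` and `|Y ∖ D| ≥ 2` force `|I| = 4`
    have hYD : (Y \ D).card = 4 - D.card := by rw [Finset.card_sdiff_of_subset hDY, hY]
    have hle : I.card ≤ 5 := hcard ▸ Finset.card_le_card hIsub
    have hYD2 : (Y \ D).card = 2 := by
      rw [hIcard, hYD] at hle
      have : 4 - D.card ≤ 2 := by
        by_contra hgt
        have h3 : 3 ≤ 4 - D.card := by omega
        have : 2 ^ 3 ≤ 2 ^ (4 - D.card) := Nat.pow_le_pow_right (by norm_num) h3
        omega
      omega
    have hI4 : I.card = 4 := by rw [hIcard, hYD2]; norm_num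
    -- the fifth member `E`
    have hrest : (𝒜 \ I).card = 1 := by rw [Finset.card_sdiff_of_subset hIsub, hcard, hI4]
    obtain ⟨E, hE⟩ := Finset.card_eq_one.mp hrest
    have hEmem : E ∈ 𝒜 ∧ E ∉ I := by
      have : E ∈ 𝒜 \ I := by rw [hE]; exact Finset.mem_singleton_self E
      exact Finset.mem_sdiff.mp this
    have hnotD : ¬ D ⊆ E := fun hDE => hEmem.2 ((hmemI E).mpr ⟨hDE, h𝒜Y E hEmem.1⟩)
    obtain ⟨d, hdD, hdE⟩ := Finset.not_subset.mp hnotD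
    refine ⟨d, hDY hdD, Finset.card_eq_one.mpr ⟨E, ?_⟩⟩
    ext A
    simp only [Finset.mem_filter, Finset.mem_singleton]
    constructor
    · rintro ⟨hA, hdA⟩
      have hAI : A ∉ I := fun hAI => hdA (((hmemI A).mp hAI).1 hdD)
      have : A ∈ 𝒜 \ I := Finset.mem_sdiff.mpr ⟨hA, hAI⟩
      rw [hE, Finset.mem_singleton] at this
      exact this
    · rintro rfl; exact ⟨hEmem.1, hdE⟩
  · /- no deep member: every member other than `Y` is a facet -/
    push Not at hdeep
    obtain ⟨A, hA, hAY⟩ := Finset.exists_mem_ne (by rw [hcard]; norm_num : 1 < 𝒜.card) Y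
    have hAsub : A ⊆ Y := h𝒜Y A hA
    have hAc : A.card = 3 := by
      have h1 := hdeep A hA
      have h2 : A.card < 4 := hY ▸ Finset.card_lt_card (Finset.ssubset_iff_subset_ne.mpr ⟨hAsub, hAY⟩)
      omega
    have hdiff : (Y \ A).card = 1 := by rw [Finset.card_sdiff_of_subset hAsub, hY, hAc]
    obtain ⟨x, hx⟩ := Finset.card_eq_one.mp hdiff
    have hxm : x ∈ Y ∧ x ∉ A := by
      have : x ∈ Y \ A := by rw [hx]; exact Finset.mem_singleton_self x
      exact Finset.mem_sdiff.mp this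
    have hAeq : ∀ A' ∈ 𝒜, x ∉ A' → A' = A := by
      intro A' hA' hxA'
      have hsub' : A' ⊆ Y.erase x := fun y hy => Finset.mem_erase.mpr ⟨fun h => hxA' (h ▸ hy), h𝒜Y A' hA' hy⟩
      have hsub : A ⊆ Y.erase x := fun y hy => Finset.mem_erase.mpr ⟨fun h => hxm.2 (h ▸ hy), hAsub hy⟩
      have hcardx : (Y.erase x).card = 3 := by rw [Finset.card_erase_of_mem hxm.1, hY]
      rw [Finset.eq_of_subset_of_card_le hsub' (by rw [hcardx]; exact hdeep A' hA'),
        Finset.eq_of_subset_of_card_le hsub (by rw [hcardx, hAc])]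
    refine ⟨x, hxm.1, Finset.card_eq_one.mpr ⟨A, ?_⟩⟩
    ext A'
    simp only [Finset.mem_filter, Finset.mem_singleton]
    exact ⟨fun h => hAeq A' h.1 h.2, fun h => h ▸ ⟨hA, hxm.2⟩⟩

/-! ## 2. The lower co-star theorem up to co-size 5, unconditionally -/

/-- **THE LOWER CO-STAR THEOREM, co-size ≤ 5.** For every `h` and `c ≤ 4`, the co-star `T_{h,c}` (one piece, `K = h` states, columns = all state
sets but the top and the co-singletons `univ ∖ {qs j}`) serves EVERY injective row family of size `2^h − (c+1)` with lower-set range. -/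
theorem coStarLower_exists_table_le_four (h c r m : ℕ) (p₀ : Fin m) (hc : c ≤ 4)
    (qs : Fin c → Fin h) (hqs : Function.Injective qs) (hr : r + (c + 1) = 2 ^ h)
    (cols : Fin r → Finset (Fin h)) (hcols : Function.Injective cols) (hcu : ∀ k, cols k ≠ Finset.univ)
    (hcq : ∀ k j, cols k ≠ Finset.univ.erase (qs j))
    (u : Fin r → Finset (Fin h)) (hu : Function.Injective u) (hlow : IsLowerSet (Set.range u)) :
    ∃ tx : Fin m → Option (Fin h) → Fin h → ℂ,
      (Matrix.of fun i k : Fin r =>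
        ∏ x ∈ u i, (tx p₀ none x + ∑ q ∈ cols k, tx p₀ (some q) x)).det ≠ 0 :=
  coStarLower_exists_table h c r m p₀ (Or.inr ⟨hc, fun Y 𝒜 hY h𝒜Y hup h5 => satFour Y 𝒜 hY h𝒜Y hup h5⟩)
    qs hqs hr cols hcols hcu hcq u hu hlow

/-! ## 3. The node cells -/

/-- **THE LOWER NODE AT `r = 2^h − 5` FOR EVERY `h ≥ 4`** (one co-star piece with four special states). -/
theorem universalJoinWideLower_top_five (h : ℕ) (h4 : 4 ≤ h) :
    ∃ (m K : ℕ) (W : Fin m → ℕ) (wt : Fin m → Fin K → ℕ) (e : Fin (2 ^ h - 5) → Fin m × Finset (Fin K)),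
      m ≤ h + h ∧ K ≤ h * h * h ∧ Function.Injective e ∧
      (∀ x : Fin m × Finset (Fin K), x ∉ Set.range e →
        ∀ i, W (e i).1 + ∑ k ∈ (e i).2, wt (e i).1 k < W x.1 + ∑ k ∈ x.2, wt x.1 k) ∧
      ∀ u : Fin (2 ^ h - 5) → Finset (Fin h), Function.Injective u → IsLowerSet (Set.range u) →
        ∃ tx : Fin m → Option (Fin K) → Fin h → ℂ,
          (Matrix.of fun i k : Fin (2 ^ h - 5) =>
            ∏ a ∈ u i, (tx (e k).1 none a + ∑ q ∈ (e k).2, tx (e k).1 (some q) a)).det ≠ 0 := by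
  have h16 : 16 ≤ 2 ^ h := by
    calc 16 = 2 ^ 4 := by norm_num
      _ ≤ 2 ^ h := Nat.pow_le_pow_right (by norm_num) h4
  exact universalJoinWideLower_of_coStar h 4 (2 ^ h - 5) (by omega) h4
    (Or.inr ⟨le_rfl, fun Y 𝒜 hY h𝒜Y hup h5 => satFour Y 𝒜 hY h𝒜Y hup h5⟩) (by omega)

/-- The lower node at the top FIVE sizes `r = 2^h − (c+1)`, `c ≤ 4`, of every `h ≥ 4` (one piece, `K = h` states). -/
theorem universalJoinWideLower_top_le_five (h c : ℕ) (h4 : 4 ≤ h) (hc : c ≤ 4) :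
    ∃ (m K : ℕ) (W : Fin m → ℕ) (wt : Fin m → Fin K → ℕ) (e : Fin (2 ^ h - (c + 1)) → Fin m × Finset (Fin K)),
      m ≤ h + h ∧ K ≤ h * h * h ∧ Function.Injective e ∧
      (∀ x : Fin m × Finset (Fin K), x ∉ Set.range e →
        ∀ i, W (e i).1 + ∑ k ∈ (e i).2, wt (e i).1 k < W x.1 + ∑ k ∈ x.2, wt x.1 k) ∧
      ∀ u : Fin (2 ^ h - (c + 1)) → Finset (Fin h), Function.Injective u → IsLowerSet (Set.range u) →
        ∃ tx : Fin m → Option (Fin K) → Fin h → ℂ,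
          (Matrix.of fun i k : Fin (2 ^ h - (c + 1)) =>
            ∏ a ∈ u i, (tx (e k).1 none a + ∑ q ∈ (e k).2, tx (e k).1 (some q) a)).det ≠ 0 := by
  have h16 : 16 ≤ 2 ^ h := by
    calc 16 = 2 ^ 4 := by norm_num
      _ ≤ 2 ^ h := Nat.pow_le_pow_right (by norm_num) h4
  exact universalJoinWideLower_of_coStar h c (2 ^ h - (c + 1)) (by omega) (by omega)
    (Or.inr ⟨hc, fun Y 𝒜 hY h𝒜Y hup h5 => satFour Y 𝒜 hY h𝒜Y hup h5⟩) (by omega)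

end CoStar

end

end Summit.ValiantsHypothesis.ValiantsHypothesis.Theorems.BarrierLever.HiddenStates
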